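import Mathlib
import Literature.Barriers.NavierStokesRegularity.DyadicCascadeRegionBound
import Literature.Analysis.FluidPDE.Tao2016AveragedNS.SelfSimilarCascadeBlowup
import HarnessLib

/-!
# `SubOnsagerCeiling.OrthantTailCeiling`, rung `stub_dyadicRatioTwo` — tools: the embedding of the
`ε₀ = 1` lattice chain into Barbato–Morandin–Romito's model (1.1) and the gluing lemma
(helper file for item stmt-NavierStokesRegularity-25507; `--supports`)

Three pieces of bookkeeping used by the rung `stub_dyadicRatioTwo` of the line «shell-barrier»
(sibling file `SubOnsagerCeilingOrthantTailCeilingDyadicRatioTwo.lean`):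

* the cascade nonlinearity of a SCALED dyadic table `α = c · dyadicTable` is `c` times the dyadic
  one (`dyadicRatioTwo_quadTerm_const_mul`, `_of_ne`, `_zero`);
* **gluing** (`dyadicRatioTwo_glue`): a solution of BMR (1.1) within `[0, s]` followed by a weak
  solution on `[0, ∞)` from the datum reached at time `s` is a weak solution on `[0, ∞)`
  (`IsBMRWeakSolution`, BMR Def. 3.1) — the one-sided derivatives at `s` agree;
* **embedding** (`dyadicRatioTwo_hasDerivWithinAt_bmr`): if `Z_k` solves the `ε₀ = 1` chain
  `Ż_k = c(2^{5(k-1)/2}Z²_{k-1} − 2^{5k/2}Z_kZ_{k+1}) − ν4^kZ_k` within `[0, s]`, then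
  `U_1 = (c/2^{5/2})σZ_0`, `U_{k+1} = (c/2^{5/2})Z_k` (`σ² = 1`) solve BMR (1.1) at `β = 5/2`,
  `λₙ = 2ⁿ`, viscosity `ν/4` (the dictionary of Tao 2016 §1.2 / BMR §1.1, with the sign of the
  datum shell absorbed by the symmetry `Z_0 ↦ -Z_0` of the chain).

HONEST FRAMING: bookkeeping about MODEL lattice ODEs (route SubOnsagerCeiling, rung TL-M2Break);
nothing here bears on Navier–Stokes regularity and no summit is proved.
-/

noncomputable section

-- the sub-problem namespace `NavierStokesRegularity.NavierStokesRegularity` is the tree's layout (D-0017)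
set_option linter.dupNamespace false

namespace Summit.NavierStokesRegularity.NavierStokesRegularity.Theorems

open Set Filter
open scoped Topology
open Literature.Analysis.FluidPDE.TaoCascade
open Literature.Barriers.NavierStokesRegularity.Dyadic

/-! ## The nonlinearity of a scaled dyadic table -/

/-- `quadTerm` is linear in the table: for `α = c·β` pointwise, `quadTerm ε₀ α = c · quadTerm ε₀ β`.
[folklore] -/
theorem dyadicRatioTwo_quadTerm_const_mul {ε₀ c : ℝ}
    {α β : Fin 4 → Fin 4 → Fin 4 → ℤ × ℤ × ℤ → ℝ}
    (h : ∀ (i₁ i₂ i₃ : Fin 4) (μ : ℤ × ℤ × ℤ), α i₁ i₂ i₃ μ = c * β i₁ i₂ i₃ μ)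
    (X : Fin 4 → ℤ → ℝ → ℝ) (i : Fin 4) (n : ℤ) (t : ℝ) :
    quadTerm ε₀ α X i n t = c * quadTerm ε₀ β X i n t := by
  simp only [quadTerm, h, Finset.mul_sum]
  refine Finset.sum_congr rfl fun i₁ _ => Finset.sum_congr rfl fun i₂ _ =>
    Finset.sum_congr rfl fun μ _ => ?_
  ring

/-- Off component `0` a scaled dyadic table has no nonlinearity. [folklore] -/
theorem dyadicRatioTwo_quadTerm_of_ne {ε₀ c : ℝ} {α : Fin 4 → Fin 4 → Fin 4 → ℤ × ℤ × ℤ → ℝ}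
    (h : ∀ (i₁ i₂ i₃ : Fin 4) (μ : ℤ × ℤ × ℤ), α i₁ i₂ i₃ μ = c * dyadicTable i₁ i₂ i₃ μ)
    (X : Fin 4 → ℤ → ℝ → ℝ) {i : Fin 4} (hi : i ≠ 0) (n : ℤ) (t : ℝ) :
    quadTerm ε₀ α X i n t = 0 := by
  rw [dyadicRatioTwo_quadTerm_const_mul h, quadTerm_dyadicTable_of_ne _ _ hi, mul_zero]

/-- On component `0`, at `ε₀ = 1`, shell `k ≥ 0`: the scaled dyadic nonlinearity is
`c(2^{5(k-1)/2} X_{0,k-1}² − 2^{5k/2} X_{0,k} X_{0,k+1})`. [folklore] -/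
theorem dyadicRatioTwo_quadTerm_zero {c : ℝ} {α : Fin 4 → Fin 4 → Fin 4 → ℤ × ℤ × ℤ → ℝ}
    (h : ∀ (i₁ i₂ i₃ : Fin 4) (μ : ℤ × ℤ × ℤ), α i₁ i₂ i₃ μ = c * dyadicTable i₁ i₂ i₃ μ)
    (X : Fin 4 → ℤ → ℝ → ℝ) (n : ℤ) (t : ℝ) :
    quadTerm 1 α X 0 n t =
      c * ((2 : ℝ) ^ ((5 : ℝ) * (n - 1) / 2) * X 0 (n - 1) t ^ 2 -
        (2 : ℝ) ^ ((5 : ℝ) * n / 2) * (X 0 n t * X 0 (n + 1) t)) := by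
  rw [dyadicRatioTwo_quadTerm_const_mul h, quadTerm_dyadicTable_zero]
  norm_num

/-! ## Gluing a finite-horizon solution of BMR (1.1) to a global one -/

/-- **Gluing.** A solution `U` of BMR (1.1) within `[0, s]` (modes `≥ 1`) followed, from time `s`,
by a weak solution `V` on `[0, ∞)` launched from the datum `U(s)` is a weak solution on `[0, ∞)`
(BMR Def. 3.1) from the datum `U(0)`: the one-sided derivatives at `s` agree because both equal
the right-hand side evaluated at `U(s)`. [folklore] -/
theorem dyadicRatioTwo_glue {ν β s : ℝ} (hβ : β ≠ 0) (hs : 0 ≤ s) {U V : ℕ → ℝ → ℝ}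
    (hU : ∀ n, 1 ≤ n → ∀ t ∈ Icc 0 s,
      HasDerivWithinAt (U n) (bmrRHS ν β (fun m => U m t) n) (Icc 0 s) t)
    (hV : IsBMRWeakSolution ν β (fun n => U n s) V) :
    IsBMRWeakSolution ν β (fun n => U n 0)
      (fun n t => if t ≤ s then U n t else V n (t - s)) := by
  refine ⟨fun n _ => by simp [hs], fun n hn t ht => ?_⟩
  obtain ⟨m, rfl⟩ : ∃ m, n = m + 1 := ⟨n - 1, by omega⟩
  set W : ℕ → ℝ → ℝ := fun n t => if t ≤ s then U n t else V n (t - s) with hW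
  -- the right-hand sides at time `t` along `W`
  have hRU : t ≤ s → bmrRHS ν β (fun k => W k t) (m + 1) = bmrRHS ν β (fun k => U k t) (m + 1) :=
    fun hts => bmrRHS_succ_congr ν hβ (fun k _ => by simp [hW, hts]) m
  have hRV : s ≤ t → bmrRHS ν β (fun k => W k t) (m + 1) =
      bmrRHS ν β (fun k => V k (t - s)) (m + 1) := by
    intro hst
    refine bmrRHS_succ_congr ν hβ (fun k hk => ?_) m
    rcases hst.lt_or_eq with hlt | heq
    · simp [hW, not_le.2 hlt]
    · subst heq; simp [hW, hV.1 k hk]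
  -- the translated global piece
  have hVsh : ∀ τ, s ≤ τ → HasDerivWithinAt (fun r => V (m + 1) (r - s))
      (bmrRHS ν β (fun k => V k (τ - s)) (m + 1)) (Ici s) τ := by
    intro τ hτ
    have h1 : HasDerivWithinAt (fun r : ℝ => r - s) 1 (Ici s) τ :=
      (hasDerivWithinAt_id τ (Ici s)).sub_const s
    have h2 := hV.2 (m + 1) (by omega) (τ - s) (by linarith)
    have := h2.comp τ h1 (fun r (hr : s ≤ r) => show (0 : ℝ) ≤ r - s by linarith)
    simpa [Function.comp_def] using this
  rcases lt_trichotomy t s with hlt | heq | hgt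
  · -- before `s`: `W = U` near `t` within `[0, ∞)`
    have hmem : Icc 0 s ∈ 𝓝[Ici 0] t :=
      mem_nhdsWithin.2 ⟨Iio s, isOpen_Iio, hlt, fun y hy => ⟨hy.2, le_of_lt hy.1⟩⟩
    have h1 : HasDerivWithinAt (U (m + 1)) (bmrRHS ν β (fun k => U k t) (m + 1)) (Ici 0) t :=
      (hU (m + 1) (by omega) t ⟨ht, hlt.le⟩).mono_of_mem_nhdsWithin hmem
    have hev : W (m + 1) =ᶠ[𝓝[Ici 0] t] U (m + 1) := by
      filter_upwards [mem_nhdsWithin_of_mem_nhds (Iio_mem_nhds hlt)] with y hy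
      have hys : y ≤ s := le_of_lt hy
      simp [hW, hys]
    rw [hRU hlt.le]
    exact h1.congr_of_eventuallyEq hev (by simp [hW, hlt.le])
  · -- at `s`: union of the left piece (from `U`) and the right piece (from `V`)
    subst heq
    have hL : HasDerivWithinAt (W (m + 1)) (bmrRHS ν β (fun k => U k t) (m + 1)) (Icc 0 t) t :=
      (hU (m + 1) (by omega) t ⟨ht, le_rfl⟩).congr (fun y hy => by simp [hW, hy.2])
        (by simp [hW])
    have hR : HasDerivWithinAt (W (m + 1)) (bmrRHS ν β (fun k => U k t) (m + 1)) (Ici t) t := by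
      have h := hVsh t le_rfl
      rw [← hRV le_rfl, hRU le_rfl] at h
      refine h.congr (fun y (hy : t ≤ y) => ?_) (by simp [hW, hV.1 (m + 1) (by omega)])
      rcases hy.lt_or_eq with hlt' | heq'
      · simp [hW, not_le.2 hlt']
      · subst heq'; simp [hW, hV.1 (m + 1) (by omega)]
    have := hL.union hR
    rw [hRU le_rfl]
    refine this.mono fun y hy => ?_
    rcases le_or_gt y t with h | h
    · exact Or.inl ⟨hy, h⟩
    · exact Or.inr h.le
  · -- after `s`: `W = V(· - s)` near `t`
    have hmem : Ici s ∈ 𝓝[Ici 0] t :=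
      mem_nhdsWithin_of_mem_nhds (mem_of_superset (Ioi_mem_nhds hgt) Ioi_subset_Ici_self)
    have h1 := (hVsh t hgt.le).mono_of_mem_nhdsWithin hmem
    have hev : W (m + 1) =ᶠ[𝓝[Ici 0] t] fun r => V (m + 1) (r - s) := by
      filter_upwards [mem_nhdsWithin_of_mem_nhds (Ioi_mem_nhds hgt)] with y hy
      simp [hW, not_le.2 (show s < y from hy)]
    rw [hRV hgt.le]
    exact h1.congr_of_eventuallyEq hev (by simp [hW, not_le.2 hgt])

/-! ## The embedding of the lattice chain into BMR (1.1) at `β = 5/2`, `λ = 2` -/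

/-- `(2^k)^r = 2^{k r}` for natural `k` and real `r`. [folklore] -/
theorem dyadicRatioTwo_two_pow_rpow (k : ℕ) (r : ℝ) :
    ((2 : ℝ) ^ k) ^ r = (2 : ℝ) ^ ((k : ℝ) * r) := by
  rw [← Real.rpow_natCast, ← Real.rpow_mul (by norm_num : (0 : ℝ) ≤ 2)]

/-- **The embedding solves BMR (1.1) within `[0, s]`.** If `Z_k` (`k ≥ -1`, `Z_{-1} ≡ 0`) solves the
`ε₀ = 1` chain `Ż_k = c(2^{5(k-1)/2}Z²_{k-1} − 2^{5k/2}Z_kZ_{k+1}) − ν4^kZ_k` within `[0, s]`, then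
`U_1 = (c/2^{5/2})σZ_0`, `U_{k+1} = (c/2^{5/2})Z_k` (`k ≥ 1`, `σ² = 1`) solve BMR (1.1) with
`β = 5/2`, `λₙ = 2ⁿ`, viscosity `ν/4`, within `[0, s]`.
[cite: BarbatoMorandinRomito2011, §1.1 (1.1)] [cite: Tao2016AveragedNS, §1.2 p. 9] -/
theorem dyadicRatioTwo_hasDerivWithinAt_bmr {c ν s σ : ℝ} (hσ : σ ^ 2 = 1)
    {Z : ℤ → ℝ → ℝ} (hvan : ∀ t, Z (-1) t = 0)
    (hode : ∀ (k : ℕ), ∀ t ∈ Icc 0 s, HasDerivWithinAt (Z k)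
      (c * ((2 : ℝ) ^ ((5 : ℝ) * ((k : ℝ) - 1) / 2) * Z ((k : ℤ) - 1) t ^ 2 -
          (2 : ℝ) ^ ((5 : ℝ) * (k : ℝ) / 2) * (Z k t * Z ((k : ℤ) + 1) t)) -
        ν * (2 : ℝ) ^ ((2 : ℝ) * (k : ℝ)) * Z k t) (Icc 0 s) t)
    {U : ℕ → ℝ → ℝ} (hU1 : ∀ t, U 1 t = c / (2 : ℝ) ^ ((5 : ℝ) / 2) * (σ * Z 0 t))
    (hU2 : ∀ k : ℕ, 1 ≤ k → ∀ t, U (k + 1) t = c / (2 : ℝ) ^ ((5 : ℝ) / 2) * Z k t) :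
    ∀ m : ℕ, ∀ t ∈ Icc 0 s,
      HasDerivWithinAt (U (m + 1)) (bmrRHS (ν / 4) (5 / 2) (fun n => U n t) (m + 1)) (Icc 0 s) t := by
  set q : ℝ := (2 : ℝ) ^ ((5 : ℝ) / 2) with hq
  have hq0 : 0 < q := Real.rpow_pos_of_pos (by norm_num) _
  have hβ : (5 / 2 : ℝ) ≠ 0 := by norm_num
  -- powers of two
  have hT : ∀ m : ℕ, (2 : ℝ) ^ ((5 : ℝ) * ((m : ℝ) - 1) / 2) * q = (2 : ℝ) ^ ((5 : ℝ) * (m : ℝ) / 2) := by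
    intro m
    rw [hq, ← Real.rpow_add (by norm_num : (0 : ℝ) < 2)]
    ring_nf
  have hL : ∀ m : ℕ, bmrLambda (m + 1) ^ (5 / 2 : ℝ) = q * (2 : ℝ) ^ ((5 : ℝ) * (m : ℝ) / 2) := by
    intro m
    rw [bmrLambda_succ, dyadicRatioTwo_two_pow_rpow, hq, ← Real.rpow_add (by norm_num : (0 : ℝ) < 2)]
    push_cast
    ring_nf
  have hW : ∀ m : ℕ, (2 : ℝ) ^ ((2 : ℝ) * (m : ℝ)) = (4 : ℝ) ^ m := by
    intro m
    rw [Real.rpow_mul (by norm_num : (0 : ℝ) ≤ 2), Real.rpow_natCast]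
    norm_num
  have hLsq : ∀ m : ℕ, bmrLambda (m + 1) ^ 2 = 4 * (4 : ℝ) ^ m := by
    intro m
    calc bmrLambda (m + 1) ^ 2 = ((2 : ℝ) ^ 2) ^ (m + 1) := by
          rw [bmrLambda_succ, ← pow_mul, ← pow_mul, mul_comm]
      _ = 4 * (4 : ℝ) ^ m := by norm_num [pow_succ, mul_comm]
  intro m t ht
  rcases Nat.eq_zero_or_pos m with rfl | hm
  · -- mode 1 = shell 0
    have hfun : U 1 = fun τ => c / q * σ * Z 0 τ := funext fun τ => by rw [hU1]; ring
    rw [show (0 : ℕ) + 1 = 1 from rfl, hfun, bmrRHS_one hβ]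
    have h := (hode 0 t ht).const_mul (c / q * σ)
    refine h.congr_deriv ?_
    have h1 : bmrLambda 1 = 2 := by rw [bmrLambda_of_ne_zero one_ne_zero, pow_one]
    have h2 : U 2 t = c / q * Z 1 t := by
      rw [show (2 : ℕ) = 1 + 1 from rfl, hU2 1 le_rfl]; push_cast; ring_nf
    rw [h1, show (2 : ℝ) ^ (5 / 2 : ℝ) = q from rfl, hU1, h2]
    simp only [Nat.cast_zero, mul_zero, zero_div, Real.rpow_zero, zero_sub, zero_add]
    rw [show (-1 : ℤ) = -1 from rfl, hvan t]
    field_simp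
    ring
  · -- mode m + 1 = shell m ≥ 1
    obtain ⟨j, rfl⟩ : ∃ j, m = j + 1 := ⟨m - 1, by omega⟩
    have hfun : U (j + 1 + 1) = fun τ => c / q * Z (j + 1 : ℕ) τ := funext fun τ => hU2 (j + 1) hm τ
    rw [hfun, bmrRHS_succ]
    have h := (hode (j + 1) t ht).const_mul (c / q)
    refine h.congr_deriv ?_
    -- the neighbouring modes
    have hUm : U (j + 1) t ^ 2 = (c / q) ^ 2 * Z (j : ℕ) t ^ 2 := by
      rcases Nat.eq_zero_or_pos j with rfl | hj
      · rw [show (0 : ℕ) + 1 = 1 from rfl, hU1]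
        push_cast
        calc (c / q * (σ * Z 0 t)) ^ 2 = (c / q) ^ 2 * σ ^ 2 * Z 0 t ^ 2 := by ring
          _ = (c / q) ^ 2 * Z 0 t ^ 2 := by rw [hσ, mul_one]
      · rw [hU2 j hj]; ring
    have hUp : U (j + 1 + 2) t = c / q * Z ((j + 1 : ℕ) + 1) t := by
      rw [show j + 1 + 2 = (j + 2) + 1 by ring, hU2 (j + 2) (by omega)]
      push_cast; ring_nf
    have hUc : U (j + 1 + 1) t = c / q * Z (j + 1 : ℕ) t := hU2 (j + 1) hm t
    have hZm : Z (((j + 1 : ℕ) : ℤ) - 1) t = Z (j : ℕ) t := by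
      congr 1; push_cast; ring
    rw [hUm, hUp, hUc, hL (j + 1), hLsq (j + 1), hZm, ← hT (j + 1), hW (j + 1)]
    rw [bmrLambda_succ, dyadicRatioTwo_two_pow_rpow]
    have : (2 : ℝ) ^ (((j + 1 : ℕ) : ℝ) * (5 / 2 : ℝ)) = (2 : ℝ) ^ ((5 : ℝ) * (((j + 1 : ℕ) : ℝ) - 1) / 2) * q := by
      rw [hT]; congr 1; ring
    rw [this]
    push_cast
    field_simp
    ring

end Summit.NavierStokesRegularity.NavierStokesRegularity.Theorems

end
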